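/-
Copyright (c) 2026 the pub-hodgecm-mathlib formalisation cell (harness21).  Prover seat hodgecm-mathlib-F0P2-p08 (g0) (L1; LEAD F0P6-plan (g14) BATCH #50 (4) «I2 → F0P2-p08»;
spec K2Liu-p02 (g7) CENSUS (u-0c) `K2/K2Liu-p02/g7/CENSUS-u0c-MiddleTermPackageInstance.K2Liu-p02-g7.md` §1 row `mx hmx (C₀ A₀)`, §2 I2): Track B «K2-LIT»,
hLiu418 = stmt-HodgeConjecture-24832, road `K2_Liu`, socket #41, ROAD Φ, organ G5 (u-0c) file I2: THE IWASAWA LEVI COORDINATE OF `H(𝔸)` AND ITS HEIGHT COMPARISON.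
-/
import Summits.HodgeConjecture.HodgeConjecture.Theorems.K2LiuModDeltaHeightComparison   -- ★ `exists_gl_coe_eq_deltaBlock`, `adelicHeightGL_deltaBlock_le`, `exists_height_le_mul_height_mul`
import Literature.NumberTheory.K2Lit.SiegelStandardSections                                 -- ★ D1′ `IwasawaDatum` (`𝒦.iwasawa`, `𝒦.isCompact_K`)
import HarnessLib

/-!
# Crux `HLiu418`, ROAD Φ, organ G5 (u-0c) file I2: the Iwasawa Levi coordinate `h = p(h)·k(h)`, `m(h) := p(h)|_Δ ∈ GL_n(𝔸_L)`, and `‖m(h)‖ ≤ C₀·‖h‖`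

Cell `hodgecm-mathlib`, crux item hLiu418 = `stmt-HodgeConjecture-24832`; squad K2 ∕ K2Liu (L1, LEAD F0P6-plan (g14)); prover F0P2-p08 (g0).  THEOREMS ONLY (no `def`,
no instance, no notation, no named-fact hypothesis, no `sorry`); lane `--supports stmt-HodgeConjecture-24832 --as helper`.

THE LETTER (the by-value binders `mx hmx (C₀ A₀)` of ★ (β0-4)′ `K2LiuMiddleCellPackageOfFacesGrowth.exists_middle_package_of_faces'` at the K2Liu datum,
`X := H(𝔸)`, `height h := ‖h‖ = adelicHeightGL (n+n) L h`).  For an Iwasawa datum `𝒦` of the doubled group `H(𝔸) = U(J^𝔻)(𝔸)` (★ D1′: `𝒦.K` compact,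
`H(𝔸) = P_Δ(𝔸)·𝒦.K`) there are maps `kx : H(𝔸) → H(𝔸)`, `mx : H(𝔸) → GL_n(𝔸_L)` and a constant `C₀ ≥ 0` such that for every `h`:
`kx h ∈ 𝒦.K`, `p(h) := h · (kx h)⁻¹ ∈ P_Δ(𝔸)` (★ `IsSiegelDelta`), `mx h` is the `Δ`-block `p(h)|_Δ` (★ `deltaBlock`, a unit by ★ `exists_gl_coe_eq_deltaBlock`), and
**`‖mx h‖ ≤ C₀ · ‖h‖^{A₀}`, `A₀ = 1`** (★ `adelicHeightGL_deltaBlock_le`: `‖p|_Δ‖ ≤ 2‖p‖`; ★ `exists_height_le_mul_height_mul` on the compact `𝒦.K`: `‖p‖ ≤ C_K‖p k‖`).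
* `exists_iwasawa_factorisation` — the choice `h = p(h)·kx h` with `p(h) ∈ P_Δ(𝔸)`, `kx h ∈ 𝒦.K`;
* **`exists_iwasawaLeviCoordinate`** — `(mx, kx, C₀, A₀)` with the four clauses above in ★ (β0-4)′'s binder shape (`adelicHeightGL n L (mx h) ≤ C₀ * ‖h‖ ^ A₀`, `0 ≤ C₀`, `0 ≤ A₀`).
[MoeglinWaldspurger1995, I.2.2 (vi)–(vii), II.1.7]; [BorelJacquet1979, §1.2, §4.1]; [Tan1999, §1].
HONEST LABEL.  Count-neutral helper: `HC_CM` is proved only modulo the 7 printed citations (2 remaining named inputs: hLiu418 = `stmt-HodgeConjecture-24832`,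
h413 = `stmt-HodgeConjecture-24833`) until rung 0 closes; this file closes no socket (the `hconj`∕`hMIDF` letters of I2 and the instance I4 are separate files).
-/

set_option autoImplicit false
set_option linter.dupNamespace false -- the mandated namespace repeats `HodgeConjecture.HodgeConjecture`

noncomputable section

open scoped Matrix Classical
open NumberField IsDedekindDomain
open Literature.NumberTheory.Automorphic Literature.NumberTheory.GaloisRepresentations
open Literature.NumberTheory.GelbartRogawski1991 Literature.NumberTheory.GelbartRogawski1991.GRConstruction
open Literature.NumberTheory.K2Lit.SiegelDoubled
open Summit.HodgeConjecture.HodgeConjecture.Cruxes.HLiu418.K2LiuModDeltaHeightComparison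

namespace Summit.HodgeConjecture.HodgeConjecture.Cruxes.HLiu418.K2LiuSiegelIwasawaLeviCoordinate

variable (L : Type) [Field L] [NumberField L] [IsCMField L]
variable {N M n : ℕ} (e : Fin N × Fin M ≃ Fin n)
  (dV : Fin N → L) (hdV : ∀ i, IsCMField.complexConj L (dV i) = dV i)
  (dW : Fin M → L) (hdW : ∀ i, IsCMField.complexConj L (dW i) = dW i)

/-- **THE IWASAWA FACTORISATION AS A CHOICE**: maps `p, kx : H(𝔸) → H(𝔸)` with `p h ∈ P_Δ(𝔸)`, `kx h ∈ 𝒦.K`, `h = p h · kx h` — and hence `p h = h · (kx h)⁻¹`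
(★ D1′ `IwasawaDatum.iwasawa`). [cite: Tan1999, §1] [cite: BorelJacquet1979, §4.1] -/
theorem exists_iwasawa_factorisation (𝒦 : IwasawaDatum L e dV hdV dW hdW) :
    ∃ kx : HA L e dV hdV dW hdW → HA L e dV hdV dW hdW,
      (∀ h, kx h ∈ 𝒦.K) ∧ ∀ h, IsSiegelDelta L e dV hdV dW hdW (h * (kx h)⁻¹) := by
  choose p k hp hk hpk using 𝒦.iwasawa
  refine ⟨k, hk, fun h => ?_⟩
  have hph : h * (k h)⁻¹ = p h := (eq_mul_inv_iff_mul_eq.2 (hpk h).symm).symm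
  rw [hph]
  exact hp h

/-- **THE IWASAWA LEVI COORDINATE AND ITS HEIGHT COMPARISON** (the `mx hmx (C₀ A₀)` binders of ★ (β0-4)′ at `X := H(𝔸)`, `height := ‖·‖_{GL_{2n}(𝔸_L)}`):
`mx h = (h·(kx h)⁻¹)|_Δ ∈ GL_n(𝔸_L)`, `kx h ∈ 𝒦.K`, `h·(kx h)⁻¹ ∈ P_Δ(𝔸)`, and `adelicHeightGL n L (mx h) ≤ C₀ · (adelicHeightGL (n+n) L h)^{A₀}` with `0 ≤ C₀`,
`0 ≤ A₀` (`A₀ = 1`, `C₀ = 2·C_K`). [cite: MoeglinWaldspurger1995, I.2.2 (vi)–(vii)] [cite: BorelJacquet1979, §1.2] [cite: Tan1999, §1] -/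
theorem exists_iwasawaLeviCoordinate [NeZero n] (𝒦 : IwasawaDatum L e dV hdV dW hdW) :
    ∃ (mx : HA L e dV hdV dW hdW → GL (Fin n) (AdeleRing (𝓞 L) L)) (kx : HA L e dV hdV dW hdW → HA L e dV hdV dW hdW) (C₀ A₀ : ℝ),
      0 ≤ C₀ ∧ 0 ≤ A₀ ∧ (∀ h, kx h ∈ 𝒦.K) ∧ (∀ h, IsSiegelDelta L e dV hdV dW hdW (h * (kx h)⁻¹)) ∧
      (∀ h, ((mx h : GL (Fin n) (AdeleRing (𝓞 L) L)) : Matrix (Fin n) (Fin n) (AdeleRing (𝓞 L) L)) = deltaBlock L e dV hdV dW hdW (h * (kx h)⁻¹)) ∧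
      ∀ h, adelicHeightGL n L (mx h) ≤ C₀ * adelicHeightGL (n + n) L ((h : HA L e dV hdV dW hdW) : GL (Fin (n + n)) (AdeleRing (𝓞 L) L)) ^ A₀ := by
  obtain ⟨kx, hk, hp⟩ := exists_iwasawa_factorisation L e dV hdV dW hdW 𝒦
  -- the `Δ`-block of the Siegel factor as an element of `GL_n(𝔸_L)`
  choose mx hmx using fun h => exists_gl_coe_eq_deltaBlock L e dV hdV dW hdW (hp h)
  -- `‖p‖ ≤ C_K ‖p k‖` on the compact `𝒦.K ⊆ GL_{2n}(𝔸_L)`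
  obtain ⟨CK, hCK0, hCK⟩ := exists_height_le_mul_height_mul (N := n + n) (K := L)
    (𝒦.isCompact_K.image (continuous_subtype_val : Continuous fun x : HA L e dV hdV dW hdW => (x : GL (Fin (n + n)) (AdeleRing (𝓞 L) L))))
  refine ⟨mx, kx, 2 * CK, 1, by positivity, zero_le_one, hk, hp, hmx, fun h => ?_⟩
  have h1 := adelicHeightGL_deltaBlock_le L e dV hdV dW hdW (hp h) (hmx h)
  have h2 := hCK ((h * (kx h)⁻¹ : HA L e dV hdV dW hdW) : GL (Fin (n + n)) (AdeleRing (𝓞 L) L)) ((kx h : HA L e dV hdV dW hdW) : GL (Fin (n + n)) (AdeleRing (𝓞 L) L))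
    ⟨kx h, hk h, rfl⟩
  rw [← Subgroup.coe_mul, inv_mul_cancel_right] at h2
  rw [Real.rpow_one]
  calc adelicHeightGL n L (mx h) ≤ 2 * adelicHeightGL (n + n) L ((h * (kx h)⁻¹ : HA L e dV hdV dW hdW) : GL (Fin (n + n)) (AdeleRing (𝓞 L) L)) := h1
    _ ≤ 2 * (CK * adelicHeightGL (n + n) L ((h : HA L e dV hdV dW hdW) : GL (Fin (n + n)) (AdeleRing (𝓞 L) L))) := by gcongr
    _ = 2 * CK * adelicHeightGL (n + n) L ((h : HA L e dV hdV dW hdW) : GL (Fin (n + n)) (AdeleRing (𝓞 L) L)) := by ring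

end Summit.HodgeConjecture.HodgeConjecture.Cruxes.HLiu418.K2LiuSiegelIwasawaLeviCoordinate

end
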